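import Literature.MathematicalPhysics.QuantumLattice.DWaveSourceNNNHoppingTwisted
import Literature.MathematicalPhysics.QuantumLattice.TwistedFlipSpaceGroupUnitary
import Literature.MathematicalPhysics.QuantumLattice.HubbardSpinChargeCertificate
import HarnessLib

/-!
# The gauge-twisted space group WITH SPIN EXCHANGE is a symmetry of the `d`-wave pair-SOURCED `t–t'` torus:
# local certificates in the flip-twisted orbit state of its eigenvectors (sixteen point operations)

Topic `MathematicalPhysics/QuantumLattice`, family `hubbard`. Sequel of `DWaveSourceNNNHoppingTwisted` (the twisted
space group `U_v D_γ 𝒢_{j(γ)+2m}` commutes with `A_L = dWaveSourceTorusTT' L tp U μ h` for every `S ⊆ D₄`) for the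
family WITH SPIN EXCHANGE `T((v, γ), f, m) = U_v D_γ F^f 𝒢_{j(γ)+f+2m}` (`TwistedFlipSpaceGroupUnitary`; `F` the spin
exchange `c_{x↑} ↔ c_{x↓}`, which reverses a singlet pair and is therefore twisted by the gauge quarter turn as well —
the sixteen-element «twisted `D₄ × ℤ₂^{flip}`» identification under which the sourced menus of cell hubbard-cq are
built, engine obsb ≥ 0.3.0).

WHAT IS ADDED. Every member fixes `Δ_d + Δ_dᴴ` (`twistedFlipSpaceGroupUnitary_conj_pairField_add_conjTranspose`) and
commutes with the sourced torus for EVERY `S ⊆ D₄` (`twistedFlipSpaceGroupUnitary_mul_dWaveSourceTorusTT'`). The spin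
exchange does NOT preserve the `S^z` eigenspaces (it maps `S^z = M` to `−M`), so the sector bookkeeping changes: every
orbit vector `T(g)ᴴ ψ` of an `S^z`-eigenvector `ψ` is again an `S^z`-eigenvector (`…_conjTranspose_mulVec_mem_fockSpinZSector`,
eigenvalue `±M`), hence `S^z`-CHARGED words still have zero expectation in the flip-twisted orbit state
(`orbitState_twistedFlip_eq_zero_of_spinZ_commutator`) — proved orbit-vector-wise instead of through a common sector.
The torus-level soundness theorem `dWaveSourceTorusTT'_re_orbitState_ge_of_twistedFlip_local_certificate_ineq` reads
`X − c·1 − κ (u·1 − E_loc) = SOS + Σ[A, Xₖ] + Σₗ (Tₗ Yₗ Tₗᴴ − Yₗ) + Σⱼ Wcⱼ + Σ dₘ • (Vₘᴴ − Vₘ) + Σ aₖ • Mₖ`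
(flip-twisted members `Tₗ`, `S^z`-charged torus words `Wcⱼ`: `S^z Wcⱼ − Wcⱼ S^z = sⱼ Wcⱼ`, `sⱼ ≠ 0`) in the flip-twisted
orbit state of every unit `S^z`-eigenvector eigenstate: `c − Σ‖aₖ‖ + κ (u − E/L²) ≤ Re ω̄^{tw,F}_ψ(X)`.

HONEST SCOPE. A response AT FIXED `h > 0` is symmetry-allowed and says nothing about `h → 0` after `L → ∞`.
Everything is PROVED (finite matrices); no definition, no named fact.

## References
* T. Koma, H. Tasaki, J. Stat. Phys. 76 (1994) 745–803, §1. [cite: KomaTasaki1994, §1]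
* O. Bratteli, D. W. Robinson II, §5.2.2, §6.2.4. [cite: BratteliRobinsonII1997, §5.2.2]
* G. Benfatto, A. Giuliani, V. Mastropietro, Ann. Henri Poincaré 7 (2006) 809, §2.1 (spin exchange symmetry).
  [cite: BenfattoGiulianiMastropietro2006, §2.1]
* J. Wang et al., Phys. Rev. X 14 (2024) 031006, §III. [cite: WangEtAl2024, §III]
* X. Han, arXiv:2006.06002 (2020), §3. [cite: Han2020Bootstrap, §3]
* D. J. Scalapino, Phys. Rep. 250 (1995) 329, §2 eq. (2.2)–(2.3). [cite: Scalapino1995, §2 eq. (2.3)]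
-/

noncomputable section

namespace Literature.MathematicalPhysics.QuantumLattice

open Matrix Finset Complex HubbardWave0 Literature.Probability.LatticeModels
open Literature.MathematicalPhysics.QuantumManyBody.StateRelaxation
open scoped ComplexOrder BigOperators

section Torus

variable {L : ℕ} [NeZero L]

/-- (Local to this section, as in `DWaveSourceNNNHopping`.) [folklore] -/
local instance (priority := high) instDecidableEqFermionTorusSrcTwF : DecidableEq (FermionTorus 2 L) :=
  LinearOrder.toDecidableEq

/-- `F^a Δ_g (F^a)ᴴ = (−1)^a Δ_g`: the spin exchange reverses the singlet pair field. [cite: Scalapino1995, §2 eq. (2.3)] -/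
theorem fockSpinFlip_pow_conj_pairField (g : Site 2 → ℝ) (a : ℕ) :
    fockSpinFlip ^ a * pairField g L * (fockSpinFlip ^ a)ᴴ = ((-1 : ℂ) ^ a) • pairField g L := by
  unfold pairField
  rw [Finset.mul_sum, Finset.sum_mul, Finset.smul_sum]
  exact Finset.sum_congr rfl fun x _ => fockSpinFlip_pow_conj_localPair g x a

/-- `F^a (Δ_g + Δ_gᴴ) (F^a)ᴴ = (−1)^a (Δ_g + Δ_gᴴ)`. [cite: Scalapino1995, §2 eq. (2.3)] -/
theorem fockSpinFlip_pow_conj_pairField_add_conjTranspose (g : Site 2 → ℝ) (a : ℕ) :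
    fockSpinFlip ^ a * (pairField g L + (pairField g L)ᴴ) * (fockSpinFlip ^ a)ᴴ =
      ((-1 : ℂ) ^ a) • (pairField g L + (pairField g L)ᴴ) := by
  have h1 := fockSpinFlip_pow_conj_pairField (L := L) g a
  have h2 : fockSpinFlip ^ a * (pairField g L)ᴴ * (fockSpinFlip ^ a)ᴴ = ((-1 : ℂ) ^ a) • (pairField g L)ᴴ := by
    have h := congrArg conjTranspose h1
    rw [conjTranspose_mul, conjTranspose_mul, conjTranspose_conjTranspose, ← Matrix.mul_assoc,
      conjTranspose_smul, star_pow, star_neg, star_one] at h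
    exact h
  rw [Matrix.mul_add, Matrix.add_mul, h1, h2, smul_add]

/-- **The sign bookkeeping of the flip twist**: `(−1)^{j(γ)+f+2m} · (−1)^f · χ_{B₁g}(γ) = 1`. [cite: Scalapino1995, §2 eq. (2.3)] -/
theorem neg_one_pow_twistFlipExp_mul (γ : DihedralGroup 4) (f m : Fin 2) :
    ((-1 : ℂ) ^ twistFlipExp γ f m) * ((-1 : ℂ) ^ f.val * b1gChar γ) = 1 := by
  rw [b1gChar_eq_b1gSign, b1gSign_eq_neg_one_pow_b1gTwist, twistFlipExp, pow_add, pow_add, pow_mul]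
  push_cast
  rw [neg_one_sq, one_pow, mul_one]
  calc (-1 : ℂ) ^ b1gTwist γ * (-1) ^ f.val * ((-1) ^ f.val * (-1) ^ b1gTwist γ)
      = ((-1 : ℂ) ^ b1gTwist γ * (-1) ^ b1gTwist γ) * ((-1) ^ f.val * (-1) ^ f.val) := by ring
    _ = 1 := by rw [← pow_add, ← two_mul, pow_mul, neg_one_sq, one_pow, ← pow_add, ← two_mul, pow_mul, neg_one_sq, one_pow,
        mul_one]

/-- **Every member of the flip-twisted family FIXES the Hermitian `d`-wave pair operator**:
`T((v, γ), f, m)(Δ_d + Δ_dᴴ)T((v, γ), f, m)ᴴ = Δ_d + Δ_dᴴ` for EVERY `γ ∈ D₄`, `f, m`.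
[cite: BratteliRobinsonII1997, §5.2.2] [cite: Scalapino1995, §2 eq. (2.3)] -/
theorem twistedFlipSpaceGroupUnitary_conj_pairField_add_conjTranspose (S : Finset (DihedralGroup 4))
    (g : ((TorusSite 2 L × ↥S) × Fin 2) × Fin 2) :
    twistedFlipSpaceGroupUnitary S g * (pairField dWaveFormFactor L + (pairField dWaveFormFactor L)ᴴ) *
        (twistedFlipSpaceGroupUnitary S g)ᴴ = pairField dWaveFormFactor L + (pairField dWaveFormFactor L)ᴴ := by
  obtain ⟨⟨⟨v, γ, hγ⟩, f⟩, m⟩ := g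
  rw [twistedFlipSpaceGroupUnitary_apply, conjTranspose_mul, conjTranspose_mul]
  dsimp only
  set UD := spaceGroupUnitary S (v, ⟨γ, hγ⟩) with hUD
  set Fk : Matrix (Finset (Orb (FermionTorus 2 L))) _ ℂ := fockSpinFlip ^ f.val with hFk
  set Ge : Matrix (Finset (Orb (FermionTorus 2 L))) _ ℂ := fockGauge (twistFlipExp γ f m) with hGe
  set Op := pairField dWaveFormFactor L + (pairField dWaveFormFactor L)ᴴ with hOp
  have hG' : Ge * Op * Geᴴ = ((-1 : ℂ) ^ twistFlipExp γ f m) • Op := by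
    rw [hGe, hOp]; exact fockGauge_conj_pairField_add_conjTranspose dWaveFormFactor _
  have hF' : Fk * Op * Fkᴴ = ((-1 : ℂ) ^ f.val) • Op := by
    rw [hFk, hOp]; exact fockSpinFlip_pow_conj_pairField_add_conjTranspose dWaveFormFactor _
  have hU' : UD * Op * UDᴴ = b1gChar γ • Op := by
    rw [hUD, hOp]; exact d4Affine_conj_pairField_add_conjTranspose γ v
  rw [show UD * Fk * Ge * Op * (Geᴴ * (Fkᴴ * UDᴴ)) = UD * (Fk * (Ge * Op * Geᴴ) * Fkᴴ) * UDᴴ by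
      simp only [Matrix.mul_assoc],
    hG', Matrix.mul_smul, Matrix.smul_mul, hF', smul_smul, Matrix.mul_smul, Matrix.smul_mul, hU', smul_smul, mul_assoc,
    neg_one_pow_twistFlipExp_mul, one_smul]

/-- `T(g)(Δ_d + Δ_dᴴ) = (Δ_d + Δ_dᴴ)T(g)` (commutator form). [cite: BratteliRobinsonII1997, §5.2.2] -/
theorem twistedFlipSpaceGroupUnitary_mul_pairField_add_conjTranspose (S : Finset (DihedralGroup 4))
    (g : ((TorusSite 2 L × ↥S) × Fin 2) × Fin 2) :
    twistedFlipSpaceGroupUnitary S g * (pairField dWaveFormFactor L + (pairField dWaveFormFactor L)ᴴ) =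
      (pairField dWaveFormFactor L + (pairField dWaveFormFactor L)ᴴ) * twistedFlipSpaceGroupUnitary S g := by
  have h := congrArg (· * twistedFlipSpaceGroupUnitary S g)
    (twistedFlipSpaceGroupUnitary_conj_pairField_add_conjTranspose (L := L) S g)
  rwa [Matrix.mul_assoc, twistedFlipSpaceGroupUnitary_conjTranspose_mul_self, Matrix.mul_one] at h

/-- **The flip-twisted family commutes with the pair-SOURCED `t–t'` torus for EVERY label set `S ⊆ D₄`**:
`T(g) A_L = A_L T(g)`, `A_L = dWaveSourceTorusTT' L tp U μ h`. [cite: KomaTasaki1994, §1] [cite: BratteliRobinsonII1997, §5.2.2] -/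
theorem twistedFlipSpaceGroupUnitary_mul_dWaveSourceTorusTT' (S : Finset (DihedralGroup 4)) (tp U μ h : ℝ)
    (g : ((TorusSite 2 L × ↥S) × Fin 2) × Fin 2) :
    twistedFlipSpaceGroupUnitary S g * dWaveSourceTorusTT' L tp U μ h =
      dWaveSourceTorusTT' L tp U μ h * twistedFlipSpaceGroupUnitary S g := by
  rw [dWaveSourceTorusTT', Matrix.mul_sub, Matrix.mul_sub, Matrix.sub_mul, Matrix.sub_mul, Matrix.mul_smul,
    Matrix.smul_mul, Matrix.mul_smul, Matrix.smul_mul, twistedFlipSpaceGroupUnitary_mul_hubbardTorusTT',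
    twistedFlipSpaceGroupUnitary_commute_totalNumber, twistedFlipSpaceGroupUnitary_mul_pairField_add_conjTranspose]

omit [NeZero L] in
/-- The spin exchange REVERSES the `S^z` eigenvalue: `F` maps `fockSpinZSector M` into `fockSpinZSector (−M)`.
[cite: BenfattoGiulianiMastropietro2006, §2.1] -/
theorem fockSpinFlip_mulVec_mem_fockSpinZSector_neg {M : ℝ} {ψ : Fock (Orb (FermionTorus 2 L))}
    (hψ : ψ ∈ fockSpinZSector M) : fockSpinFlip *ᵥ ψ ∈ fockSpinZSector (-M) := by
  rw [mem_fockSpinZSector_iff] at hψ ⊢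
  have hF : (fockSpinFlip : Matrix (Finset (Orb (FermionTorus 2 L))) _ ℂ) * HubbardWave0.spinZ * fockSpinFlipᴴ =
      -HubbardWave0.spinZ := by
    rw [fockSpinFlip_def, ← relabel_eq_fockRelabel_conj, relabel_spinSwap_spinZ]
  have h1 : (fockSpinFlip : Matrix (Finset (Orb (FermionTorus 2 L))) _ ℂ) * HubbardWave0.spinZ =
      -(HubbardWave0.spinZ * fockSpinFlip) := by
    have h : (fockSpinFlip : Matrix (Finset (Orb (FermionTorus 2 L))) _ ℂ) * HubbardWave0.spinZ * fockSpinFlipᴴ *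
        fockSpinFlip = -HubbardWave0.spinZ * fockSpinFlip := by rw [hF]
    rwa [Matrix.mul_assoc, fockSpinFlip_conjTranspose_mul_self, Matrix.mul_one, Matrix.neg_mul] at h
  have hcomm : HubbardWave0.spinZ * (fockSpinFlip : Matrix (Finset (Orb (FermionTorus 2 L))) _ ℂ) =
      -(fockSpinFlip * HubbardWave0.spinZ) := by
    rw [h1, neg_neg]
  rw [mulVec_mulVec, hcomm, Matrix.neg_mulVec, ← mulVec_mulVec, hψ, mulVec_smul, Complex.ofReal_neg, neg_smul]

omit [NeZero L] in
/-- `F^a` maps `fockSpinZSector M` into `fockSpinZSector ((−1)^a M)`. [cite: BenfattoGiulianiMastropietro2006, §2.1] -/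
theorem fockSpinFlip_pow_mulVec_mem_fockSpinZSector {M : ℝ} {ψ : Fock (Orb (FermionTorus 2 L))}
    (hψ : ψ ∈ fockSpinZSector M) (a : ℕ) : fockSpinFlip ^ a *ᵥ ψ ∈ fockSpinZSector ((-1 : ℝ) ^ a * M) := by
  induction a with
  | zero => simpa using hψ
  | succ a ih =>
    have h := fockSpinFlip_mulVec_mem_fockSpinZSector_neg ih
    rw [mulVec_mulVec, ← pow_succ'] at h
    have hr : (-1 : ℝ) ^ (a + 1) * M = -((-1 : ℝ) ^ a * M) := by ring
    rw [hr]
    exact h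

/-- **Orbit vectors of the flip-twisted family are `S^z`-eigenvectors**: for `ψ ∈ fockSpinZSector M`,
`T(g)ᴴ ψ ∈ fockSpinZSector M'` for some real `M'` (`= ±M`). [cite: Han2020Bootstrap, §3] -/
theorem twistedFlipSpaceGroupUnitary_conjTranspose_mulVec_mem_fockSpinZSector (S : Finset (DihedralGroup 4))
    (g : ((TorusSite 2 L × ↥S) × Fin 2) × Fin 2) {M : ℝ} {ψ : Fock (Orb (FermionTorus 2 L))}
    (hψ : ψ ∈ fockSpinZSector M) :
    ∃ M' : ℝ, (twistedFlipSpaceGroupUnitary S g)ᴴ *ᵥ ψ ∈ fockSpinZSector M' := by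
  refine ⟨(-1 : ℝ) ^ g.1.2.val * M, ?_⟩
  rw [twistedFlipSpaceGroupUnitary_apply, conjTranspose_mul, conjTranspose_mul, ← mulVec_mulVec, ← mulVec_mulVec,
    conjTranspose_fockGauge, conjTranspose_pow, conjTranspose_fockSpinFlip]
  exact fockGauge_mulVec_mem_fockSpinZSector _
    (fockSpinFlip_pow_mulVec_mem_fockSpinZSector (spaceGroupUnitary_conjTranspose_mulVec_mem_fockSpinZSector S g.1.1 hψ) _)

/-- **`S^z`-charged words have zero expectation in the flip-twisted orbit state** of an `S^z`-eigenvector: if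
`S^z W − W S^z = s W` with `s ≠ 0`, then `ω̄^{tw,F}_ψ(W) = 0` (each orbit vector is an `S^z`-eigenvector,
`vectorState_commutator`). [cite: Han2020Bootstrap, §3] -/
theorem orbitState_twistedFlip_eq_zero_of_spinZ_commutator (S : Finset (DihedralGroup 4)) {M : ℝ}
    {ψ : Fock (Orb (FermionTorus 2 L))} (hψ : ψ ∈ fockSpinZSector M)
    {W : Matrix (Finset (Orb (FermionTorus 2 L))) (Finset (Orb (FermionTorus 2 L))) ℂ} {s : ℂ} (hs : s ≠ 0)
    (hW : HubbardWave0.spinZ * W - W * HubbardWave0.spinZ = s • W) :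
    orbitState (twistedFlipSpaceGroupUnitary S) ψ W = 0 := by
  rw [orbitState_apply]
  refine mul_eq_zero_of_right _ (Finset.sum_eq_zero fun g _ => ?_)
  obtain ⟨M', hM'⟩ := twistedFlipSpaceGroupUnitary_conjTranspose_mulVec_mem_fockSpinZSector S g hψ
  have h0 := vectorState_commutator HubbardWave0.spinZ_isHermitian (spinZ_mulVec_of_mem_fockSpinZSector hM') W
  rw [hW, map_smul, smul_eq_mul] at h0
  exact (mul_eq_zero.1 h0).resolve_left hs

end Torus

/-! ### The torus theorem: a local certificate with FLIP-TWISTED symmetry defects and `S^z`-charged words, read in the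
flip-twisted orbit state of an eigenvector of the sourced Hamiltonian -/

section Certificate

variable {L : ℕ} [NeZero L]

/-- (Local to this section, as in `DWaveSourceNNNHopping`.) [folklore] -/
local instance (priority := high) instDecidableEqFermionTorusSrcTwFCert : DecidableEq (FermionTorus 2 L) :=
  LinearOrder.toDecidableEq

/-- Moving the charged-word sum into the objective: `X − c − E = S + (K + Y + W) + R ⇒ (X − W) − c − E = S + (K + Y) + R`.
[folklore] -/
private theorem cert_sub_charged {A : Type*} [AddCommGroup A] {X c E Sg K Y W R : A}
    (h : X - c - E = Sg + (K + Y + W) + R) : X - W - c - E = Sg + (K + Y) + R := by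
  have h' : Sg + (K + Y) + R = X - c - E - W := by rw [h]; abel
  rw [h']
  abel

/-- **Certificate with an energy constraint, FLIP-TWISTED symmetry defects and `S^z`-charged words ⇒ flip-twisted
orbit-averaged expectation of a local observable in EVERY `S^z`-eigenvector eigenstate of the pair-sourced `t–t'` torus
— sixteen point operations.** Let `A = dWaveSourceTorusTT' L tp U μ h`, `ψ ∈ fockSpinZSector M` a unit vector with
`A ψ = E ψ`, `S ⊆ D₄` ANY finite set of labels containing `1` and closed under multiplication, `ω̄^{tw,F}_ψ` the orbit
state over `T((v, γ), f, m) = U_v D_γ F^f 𝒢_{j(γ)+f+2m}`, `γ ∈ S`. Suppose the translates of `E_loc` sum to `A` and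
`X − c·1 − κ (u·1 − E_loc) = Σ Λₐᵦ Oₐᴴ O_b + (Σₖ (A Xₖ − Xₖ A) + Σₗ (Tₗ Yₗ Tₗᴴ − Yₗ) + Σⱼ Wcⱼ) + (Σₘ dₘ • (Vₘᴴ − Vₘ) + Σₖ aₖ • Mₖ)`
with `Λ ⪰ 0`, flip-twisted members `Tₗ`, `S^z`-CHARGED words `Wcⱼ` (`S^z Wcⱼ − Wcⱼ S^z = sⱼ • Wcⱼ`, `sⱼ ≠ 0`), real `dₘ`,
contractions `Mₖ`. Then `c − Σₖ ‖aₖ‖ + κ (u − E/L²) ≤ Re ω̄^{tw,F}_ψ(X)` (tree `re_orbitState_ge_of_local_certificate_ineq` on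
the full space for `X − Σⱼ Wcⱼ`, plus `orbitState_twistedFlip_eq_zero_of_spinZ_commutator`). [cite: WangEtAl2024, §III]
[cite: Han2020Bootstrap, §3] -/
theorem dWaveSourceTorusTT'_re_orbitState_ge_of_twistedFlip_local_certificate_ineq (tp U μ h : ℝ) {M : ℝ}
    {S : Finset (DihedralGroup 4)} (h1 : (1 : DihedralGroup 4) ∈ S) (hmul : ∀ a ∈ S, ∀ b ∈ S, a * b ∈ S)
    {ψ : Fock (Orb (FermionTorus 2 L))} (hψK : ψ ∈ fockSpinZSector M)
    (hψ1 : star ψ ⬝ᵥ ψ = 1) {E : ℝ} (hHψ : dWaveSourceTorusTT' L tp U μ h *ᵥ ψ = (E : ℂ) • ψ)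
    (X Eloc : Matrix (Finset (Orb (FermionTorus 2 L))) (Finset (Orb (FermionTorus 2 L))) ℂ)
    (hE : ∑ v : TorusSite 2 L, (fockTranslate v).val * Eloc * (fockTranslate v).valᴴ =
      dWaveSourceTorusTT' L tp U μ h) (κ u : ℝ)
    {m : Type*} [Fintype m] [DecidableEq m] {Λm : Matrix m m ℂ} (hΛ : Λm.PosSemidef)
    (O : m → Matrix (Finset (Orb (FermionTorus 2 L))) (Finset (Orb (FermionTorus 2 L))) ℂ)
    {κ' : Type*} (s : Finset κ')
    (Xc : κ' → Matrix (Finset (Orb (FermionTorus 2 L))) (Finset (Orb (FermionTorus 2 L))) ℂ)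
    {ι : Type*} (tt : Finset ι) (γ : ι → DihedralGroup 4) (hγS : ∀ l ∈ tt, γ l ∈ S)
    (wv : ι → TorusSite 2 L) (fl mt : ι → Fin 2)
    (Y : ι → Matrix (Finset (Orb (FermionTorus 2 L))) (Finset (Orb (FermionTorus 2 L))) ℂ)
    {γ' : Type*} (u' : Finset γ')
    (Wc : γ' → Matrix (Finset (Orb (FermionTorus 2 L))) (Finset (Orb (FermionTorus 2 L))) ℂ) (sc : γ' → ℂ)
    (hsc : ∀ j ∈ u', sc j ≠ 0)
    (hWc : ∀ j ∈ u', HubbardWave0.spinZ * Wc j - Wc j * HubbardWave0.spinZ = sc j • Wc j)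
    {δ : Type*} (ah : Finset δ) (dc : δ → ℝ)
    (V : δ → Matrix (Finset (Orb (FermionTorus 2 L))) (Finset (Orb (FermionTorus 2 L))) ℂ)
    {κ'' : Type*} (w : Finset κ'') (a : κ'' → ℂ)
    (Mw : κ'' → Matrix (Finset (Orb (FermionTorus 2 L))) (Finset (Orb (FermionTorus 2 L))) ℂ)
    (hM : ∀ k ∈ w, (Mw k).IsContraction) {c : ℝ}
    (hcert : X - (c : ℂ) • (1 : Matrix (Finset (Orb (FermionTorus 2 L))) (Finset (Orb (FermionTorus 2 L))) ℂ) -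
        ((κ : ℝ) : ℂ) • (((u : ℝ) : ℂ) •
          (1 : Matrix (Finset (Orb (FermionTorus 2 L))) (Finset (Orb (FermionTorus 2 L))) ℂ) - Eloc) =
      gramForm Λm O +
        (∑ k ∈ s, (dWaveSourceTorusTT' L tp U μ h * Xc k - Xc k * dWaveSourceTorusTT' L tp U μ h) +
          ∑ l ∈ tt, ((fockTranslate (wv l)).val * (fockD4 (L := L) (γ l)).val * fockSpinFlip ^ (fl l).val *
              fockGauge (twistFlipExp (γ l) (fl l) (mt l)) * Y l *
              ((fockTranslate (wv l)).val * (fockD4 (L := L) (γ l)).val * fockSpinFlip ^ (fl l).val *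
                fockGauge (twistFlipExp (γ l) (fl l) (mt l)))ᴴ - Y l) +
          ∑ j ∈ u', Wc j) +
        (∑ m' ∈ ah, ((dc m' : ℝ) : ℂ) • ((V m')ᴴ - V m') + ∑ k ∈ w, a k • Mw k)) :
    c - ∑ k ∈ w, ‖a k‖ + κ * (u - E / (L : ℝ) ^ 2) ≤
      (orbitState (twistedFlipSpaceGroupUnitary S) ψ X).re := by
  haveI : Nonempty ↥S := ⟨⟨1, h1⟩⟩
  have hA : (dWaveSourceTorusTT' L tp U μ h).IsHermitian := dWaveSourceTorusTT'_isHermitian L tp U μ h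
  have hUT : ∀ l ∈ tt, ∃ σ : (((TorusSite 2 L × ↥S) × Fin 2) × Fin 2) ≃ (((TorusSite 2 L × ↥S) × Fin 2) × Fin 2), ∀ g',
      twistedFlipSpaceGroupUnitary S g' *
          ((fockTranslate (wv l)).val * (fockD4 (L := L) (γ l)).val * fockSpinFlip ^ (fl l).val *
            fockGauge (twistFlipExp (γ l) (fl l) (mt l))) =
        twistedFlipSpaceGroupUnitary S (σ g') := fun l hl =>
    twistedFlipSpaceGroupUnitary_closed (L := L) hmul (wv l) (hγS l hl) (fl l) (mt l)
  -- the certificate for the objective `X − Σⱼ Wcⱼ`, charged words removed from the rows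
  have hcert' := cert_sub_charged hcert
  have h := re_orbitState_ge_of_local_certificate_ineq hA ⊤ (Submodule.mem_top : ψ ∈ (⊤ : Submodule ℂ _)) hψ1 hHψ
    (twistedFlipSpaceGroupUnitary S) (fun g' => twistedFlipSpaceGroupUnitary_mul_dWaveSourceTorusTT' S tp U μ h g')
    (fun g' => twistedFlipSpaceGroupUnitary_conjTranspose_mul_self S g') (fun _ _ _ => Submodule.mem_top)
    (fun v => (fockTranslate v).val) (fun v => twistedFlipSpaceGroupUnitary_closed_translate h1 hmul v)
    (X - ∑ j ∈ u', Wc j) Eloc hE κ u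
    (∅ : Finset (Fin 0)) (fun _ => 0) (fun _ => 0) (fun _ => 0) (fun _ => 0) (fun _ => 0)
    (fun i hi => absurd hi (Finset.notMem_empty i)) (fun i hi => absurd hi (Finset.notMem_empty i))
    hΛ O s Xc tt
    (fun l => (fockTranslate (wv l)).val * (fockD4 (L := L) (γ l)).val * fockSpinFlip ^ (fl l).val *
      fockGauge (twistFlipExp (γ l) (fl l) (mt l))) Y hUT
    (∅ : Finset (Fin 0)) (fun _ => 0) (fun _ => 0) (fun _ => 0) (fun _ => 0)
    (fun i hi => absurd hi (Finset.notMem_empty i)) (fun i hi => absurd hi (Finset.notMem_empty i))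
    (∅ : Finset (Fin 0)) (fun _ => 0) (fun _ => 0) (fun _ => 0)
    (fun i hi => absurd hi (Finset.notMem_empty i)) (fun i hi => absurd hi (Finset.notMem_empty i))
    ah dc V w a Mw hM (by
      rw [Finset.sum_empty, sub_zero, Finset.sum_empty, Finset.sum_empty, add_zero, add_zero]
      exact hcert')
  rw [card_torusSite, Finset.sum_empty, add_zero] at h
  push_cast at h
  -- the charged words have zero expectation
  have hzero : orbitState (twistedFlipSpaceGroupUnitary S) ψ (∑ j ∈ u', Wc j) = 0 := by
    rw [map_sum]
    exact Finset.sum_eq_zero fun j hj =>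
      orbitState_twistedFlip_eq_zero_of_spinZ_commutator S hψK (hsc j hj) (hWc j hj)
  rw [map_sub, hzero, sub_zero] at h
  exact h

end Certificate

end Literature.MathematicalPhysics.QuantumLattice

end
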